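import Summits.RiemannHypothesis.RiemannHypothesis.Theorems.JensenLogBandArcSaddleCurvature
import Summits.RiemannHypothesis.RiemannHypothesis.Theorems.JensenLogBandArcDescentDeriv
import Mathlib.MeasureTheory.Integral.CircleIntegral
import HarnessLib

/-!
# The window phase: derivative of the descent density and the inner disc (BAND line, S4b-1)

RH ladder column JENSEN, rung J-P(P3) «log band», BAND crux `XiDerivBandRealAllRates` of route
«JensenLogBand», line «band-one-window» (u-arc reshape), lead rh-jensen-prover g7 — scaffolding
for step (S4b) «local cubic» of HOME/rh-jensen-prover/g7-work/LINE-PLAN.md §8.2. RH-FREE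
(Γ-factor only). WHAT THIS IS NOT: nothing here bears on zeros of `ζ` or the truth of RH.

* `norm_arcSaddle_sub_center_le_half`: a zero `u*` of `S_{n,c}` in the disc `|u−(c+h)| ≤ (3/5)h`
  actually lies in `|u−(c+h)| ≤ h/2` (it is a fixed point of `u ↦ c + n/D(u)`, and the sharper
  maps-into bound holds for `n ≥ 100`); so the arc `u(φ₀+ψ)` stays inside the `(3/5)h`-disc for
  `r|ψ| ≤ h/10`, where `hasDerivAt_arcSaddleFn` applies.
* `hasDerivAt_descentDensity`: along the arc `u(θ) = c + r e^{iθ}`, the log-derivative density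
  `q(θ) = i(u−c)·S_{n,c}(u)` has `q′(θ) = −(u−c)·S(u) − (u−c)²·S′(u)` (at points of the disc).
* `descentDensity_saddle`: at the saddle `q(φ₀) = 0` and `q′(φ₀) = −(u*−c)²S′(u*) = −n(1+ε)`,
  `|ε| ≤ 9/20` (`arcSaddle_curvature_bound`) — the complex curvature `w = −q′(φ₀)/2` of the
  Laplace window (`laplace_window_core`), `Re w ≥ (11/40)·n`.
-/

noncomputable section

-- single-problem summit: `Summit.RiemannHypothesis.RiemannHypothesis.…` is the tree convention
set_option linter.dupNamespace false

open Complex Real Set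

namespace Summit.RiemannHypothesis.RiemannHypothesis.Theorems.JensenPolynomials.LogBandArc

open Literature.NumberTheory.LFunctions

variable {n : ℕ} {x T : ℝ} {u : ℂ}

/-- **The saddle lies in the inner disc** `|u* − (c+h)| ≤ h/2`. [folklore] -/
theorem norm_arcSaddle_sub_center_le_half (hx : |x| ≤ 1 / 2) (hT : 100 ≤ T) (hℓ : 20 ≤ ell T)
    (hn : 100 ≤ n) (hh : 1 / 2 ≤ bandRadius n T) (hhT : bandRadius n T ≤ 7 / 20 * T)
    (hu : ‖u - ((x : ℂ) + (T : ℂ) * I + bandRadius n T)‖ ≤ 3 / 5 * bandRadius n T)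
    (hS : arcSaddleFn n ((x : ℂ) + (T : ℂ) * I) u = 0) :
    ‖u - ((x : ℂ) + (T : ℂ) * I + bandRadius n T)‖ ≤ 1 / 2 * bandRadius n T := by
  set h := bandRadius n T with hhdef
  set ℓ := ell T with hℓdef
  set c : ℂ := (x : ℂ) + (T : ℂ) * I with hc
  set D := saddleDen n c u with hD
  have heq : u - c = (n : ℂ) / D := sub_eq_div_saddleDen_of_arcSaddleFn_eq_zero hx hT hℓ hn hh hhT hu hS
  obtain ⟨hR_lo, hR_hi, hJ_lo, hJ_hi⟩ := saddleDen_re_im_bounds hx hT hℓ hh hhT hu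
  rw [← hD] at hR_lo hR_hi hJ_lo hJ_hi
  have hhℓ : h * ℓ = 2 * ((n : ℝ) + 1) := bandRadius_mul_ell hℓ
  have hn' : (100 : ℝ) ≤ n := by exact_mod_cast hn
  have hnormD : 9 / 20 * ℓ ≤ ‖D‖ := hR_lo.trans ((le_abs_self _).trans (Complex.abs_re_le_norm D))
  have hD0 : D ≠ 0 := by
    intro h0; rw [h0, norm_zero] at hnormD; linarith
  have hrew : u - (c + (h : ℂ)) = ((n : ℂ) - (h : ℂ) * D) / D := by
    rw [show u - (c + (h : ℂ)) = (u - c) - h by ring, heq]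
    field_simp
  rw [hrew, norm_div, div_le_iff₀ (norm_pos_iff.2 hD0)]
  have hre : ((n : ℂ) - (h : ℂ) * D).re = (n : ℝ) - h * D.re := by simp
  have him : ((n : ℂ) - (h : ℂ) * D).im = -(h * D.im) := by simp
  have hN := Complex.norm_le_abs_re_add_abs_im ((n : ℂ) - (h : ℂ) * D)
  rw [hre, him, abs_neg] at hN
  have h1 : |(n : ℝ) - h * D.re| ≤ 3 / 25 * ((n : ℝ) + 1) + 1 := by
    rw [abs_le]
    constructor
    · have : h * D.re ≤ h * (14 / 25 * ℓ) := mul_le_mul_of_nonneg_left hR_hi (by linarith)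
      nlinarith only [this, hhℓ, hn']
    · have : h * (9 / 20 * ℓ) ≤ h * D.re := mul_le_mul_of_nonneg_left hR_lo (by linarith)
      nlinarith only [this, hhℓ, hn']
  have h2 : |h * D.im| ≤ 9 / 10 * h + ((n : ℝ) + 1) / 5 := by
    rw [abs_le]
    constructor
    · have : h * (-(1 / 10)) ≤ h * D.im := mul_le_mul_of_nonneg_left hJ_lo (by linarith)
      nlinarith only [this, hhℓ, hn', hh]
    · have : h * D.im ≤ h * (9 / 10 + ℓ / 10) := mul_le_mul_of_nonneg_left hJ_hi (by linarith)
      nlinarith only [this, hhℓ]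
  have h3 : 3 / 25 * ((n : ℝ) + 1) + 1 + (9 / 10 * h + ((n : ℝ) + 1) / 5) ≤ 1 / 2 * h * (9 / 20 * ℓ) := by
    have hten : 10 * h ≤ (n : ℝ) + 1 := by nlinarith only [hhℓ, hℓ, hh]
    nlinarith only [hhℓ, hten, hn', hh]
  calc ‖(n : ℂ) - (h : ℂ) * D‖ ≤ |(n : ℝ) - h * D.re| + |h * D.im| := hN
    _ ≤ 3 / 25 * ((n : ℝ) + 1) + 1 + (9 / 10 * h + ((n : ℝ) + 1) / 5) := add_le_add h1 h2
    _ ≤ 1 / 2 * h * (9 / 20 * ℓ) := h3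
    _ ≤ 1 / 2 * h * ‖D‖ := mul_le_mul_of_nonneg_left hnormD (by linarith)

/-- Points of the arc through the saddle with `r|ψ| ≤ h/10` stay in the `(3/5)h`-disc. [folklore] -/
theorem circleMap_mem_disc_of_near_saddle {c ustar : ℂ} {h r φ₀ ψ : ℝ}
    (hstar : ‖ustar - (c + h)‖ ≤ 1 / 2 * h) (heq : ustar = circleMap c r φ₀) (hr : 0 ≤ r)
    (hψ : r * |ψ| ≤ 1 / 10 * h) :
    ‖circleMap c r (φ₀ + ψ) - (c + h)‖ ≤ 3 / 5 * h := by
  have hdist : ‖circleMap c r (φ₀ + ψ) - circleMap c r φ₀‖ ≤ r * |ψ| := by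
    rw [circleMap, circleMap, show c + r * cexp (↑(φ₀ + ψ) * I) - (c + r * cexp (↑φ₀ * I)) =
      r * (cexp (↑(φ₀ + ψ) * I) - cexp (↑φ₀ * I)) by ring, norm_mul, Complex.norm_real,
      Real.norm_eq_abs, abs_of_nonneg hr]
    refine mul_le_mul_of_nonneg_left ?_ hr
    have e : cexp (↑(φ₀ + ψ) * I) - cexp (↑φ₀ * I) = cexp (↑φ₀ * I) * (cexp (↑ψ * I) - 1) := by
      rw [mul_sub, mul_one, ← Complex.exp_add]; push_cast; ring_nf
    rw [e, norm_mul, Complex.norm_exp_ofReal_mul_I, one_mul]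
    have := Real.norm_exp_I_mul_ofReal_sub_one_le (x := ψ)
    simpa [mul_comm] using this
  calc ‖circleMap c r (φ₀ + ψ) - (c + h)‖
      = ‖(circleMap c r (φ₀ + ψ) - circleMap c r φ₀) + (ustar - (c + h))‖ := by rw [heq]; ring_nf
    _ ≤ ‖circleMap c r (φ₀ + ψ) - circleMap c r φ₀‖ + ‖ustar - (c + h)‖ := norm_add_le _ _
    _ ≤ r * |ψ| + 1 / 2 * h := add_le_add hdist hstar
    _ ≤ 3 / 5 * h := by linarith

/-- **Derivative of the descent density along the arc:** at an angle `θ` whose point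
`u = c + r e^{iθ}` lies in the `(3/5)h`-disc, `q(θ) = i(u−c)·S_{n,c}(u)` has
`q′(θ) = −(u−c)·S(u) − (u−c)²·S′(u)`, where `S′(u) = D′ + n/(u−c)²` is the derivative from
`hasDerivAt_arcSaddleFn`. [folklore] -/
theorem hasDerivAt_descentDensity (hx : |x| ≤ 1 / 2) (hT : 100 ≤ T) (hℓ : 20 ≤ ell T)
    (hn : 100 ≤ n) (hh : 1 / 2 ≤ bandRadius n T) (hhT : bandRadius n T ≤ 7 / 20 * T) {r θ : ℝ}
    (hmem : ‖circleMap ((x : ℂ) + (T : ℂ) * I) r θ - ((x : ℂ) + (T : ℂ) * I + bandRadius n T)‖ ≤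
      3 / 5 * bandRadius n T) :
    ∃ S' : ℂ, HasDerivAt (arcSaddleFn n ((x : ℂ) + (T : ℂ) * I)) S'
        (circleMap ((x : ℂ) + (T : ℂ) * I) r θ) ∧
      ‖S' * (circleMap ((x : ℂ) + (T : ℂ) * I) r θ - ((x : ℂ) + (T : ℂ) * I)) ^ 2 - n‖ ≤
        (33 / 4 / T + 1 / (79 / 100 * T) ^ 2 + ((n : ℝ) + 1) / (179 / 100 * T) ^ 2) * r ^ 2 ∧
      HasDerivAt (fun t : ℝ => I * (circleMap ((x : ℂ) + (T : ℂ) * I) r t - ((x : ℂ) + (T : ℂ) * I)) *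
          arcSaddleFn n ((x : ℂ) + (T : ℂ) * I) (circleMap ((x : ℂ) + (T : ℂ) * I) r t))
        (-(circleMap ((x : ℂ) + (T : ℂ) * I) r θ - ((x : ℂ) + (T : ℂ) * I)) *
            arcSaddleFn n ((x : ℂ) + (T : ℂ) * I) (circleMap ((x : ℂ) + (T : ℂ) * I) r θ) -
          (circleMap ((x : ℂ) + (T : ℂ) * I) r θ - ((x : ℂ) + (T : ℂ) * I)) ^ 2 * S') θ := by
  set c : ℂ := (x : ℂ) + (T : ℂ) * I with hc
  set u : ℂ := circleMap c r θ with hu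
  obtain ⟨D', hD', hb⟩ := hasDerivAt_arcSaddleFn hx hT hℓ hn hh hhT hmem
  set S' : ℂ := D' + (n : ℂ) / (u - c) ^ 2 with hS'
  refine ⟨S', hD', ?_, ?_⟩
  · -- `S'(u−c)² − n = D'(u−c)²` when `u ≠ c`; if `u = c` then `r = 0` and both sides are `‖−n‖ ≤ 0`?? — handle
    by_cases huc : u - c = 0
    · -- then `r = 0`: `‖circleMap c r θ − c‖ = |r|`
      have hr : r = 0 := by
        have : ‖u - c‖ = |r| := by rw [hu, circleMap_sub_center, norm_circleMap_zero]
        rw [huc, norm_zero] at this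
        exact (abs_eq_zero.1 this.symm)
      -- the disc does not contain `c` (`‖c − (c+h)‖ = h > 3h/5`): contradiction
      exfalso
      have hh0 : 0 < bandRadius n T := by linarith
      have : ‖u - (c + bandRadius n T)‖ = bandRadius n T := by
        rw [show u - (c + (bandRadius n T : ℂ)) = (u - c) - bandRadius n T by ring, huc, zero_sub,
          norm_neg, Complex.norm_real, Real.norm_eq_abs, abs_of_pos hh0]
      have hmem' : ‖u - (c + bandRadius n T)‖ ≤ 3 / 5 * bandRadius n T := hmem
      linarith
    · have e : S' * (u - c) ^ 2 - n = D' * (u - c) ^ 2 := by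
        rw [hS']; field_simp; ring
      rw [e, norm_mul, norm_pow, hu, circleMap_sub_center, norm_circleMap_zero, sq_abs]
      exact mul_le_mul_of_nonneg_right hb (sq_nonneg r)
  · have hcm : HasDerivAt (fun t : ℝ => circleMap c r t - c) (circleMap 0 r θ * I) θ :=
      (hasDerivAt_circleMap c r θ).sub_const c
    have hS : HasDerivAt (fun t : ℝ => arcSaddleFn n c (circleMap c r t)) (S' * (circleMap 0 r θ * I)) θ := by
      have hD'2 : HasDerivAt (arcSaddleFn n c) S' (circleMap c r θ) := hD'
      exact HasDerivAt.comp θ hD'2 (hasDerivAt_circleMap c r θ)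
    have hprod := ((hcm.const_mul I).mul hS)
    refine hprod.congr_deriv ?_
    have e0 : circleMap 0 r θ = u - c := by rw [hu, circleMap_sub_center]
    rw [e0]
    ring_nf
    rw [Complex.I_sq]
    ring

/-- **At the saddle:** `q(φ₀) = 0`, and `q′(φ₀) = −(u*−c)²·S′(u*)` with
`‖(u*−c)²S′(u*) − n‖ ≤ (9/20)n` — so the window curvature `w := (u*−c)²S′(u*)/2` has
`Re w ≥ (11/40)n` and `‖w‖ ≤ (29/40)n`. [folklore] -/
theorem descentDensity_saddle {ustar : ℂ} (hx : |x| ≤ 1 / 2) (hT : 100 ≤ T) (hℓ : 20 ≤ ell T)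
    (hn : 100 ≤ n) (hh : 1 / 2 ≤ bandRadius n T) (hhT : bandRadius n T ≤ 7 / 20 * T)
    (hustar : ‖ustar - ((x : ℂ) + (T : ℂ) * I + bandRadius n T)‖ ≤ 3 / 5 * bandRadius n T)
    (hS : arcSaddleFn n ((x : ℂ) + (T : ℂ) * I) ustar = 0) :
    I * (ustar - ((x : ℂ) + (T : ℂ) * I)) * arcSaddleFn n ((x : ℂ) + (T : ℂ) * I) ustar = 0 ∧
    (11 / 40 : ℝ) * n ≤ (deriv (arcSaddleFn n ((x : ℂ) + (T : ℂ) * I)) ustar *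
        (ustar - ((x : ℂ) + (T : ℂ) * I)) ^ 2 / 2).re ∧
    ‖deriv (arcSaddleFn n ((x : ℂ) + (T : ℂ) * I)) ustar *
        (ustar - ((x : ℂ) + (T : ℂ) * I)) ^ 2 / 2‖ ≤ 29 / 40 * n := by
  have hcurv := arcSaddle_curvature_bound hx hT hℓ hn hh hhT hustar hS
  set Z : ℂ := deriv (arcSaddleFn n ((x : ℂ) + (T : ℂ) * I)) ustar *
    (ustar - ((x : ℂ) + (T : ℂ) * I)) ^ 2 with hZ
  refine ⟨by rw [hS, mul_zero], ?_, ?_⟩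
  · have h1 : |(Z - n).re| ≤ 9 / 20 * n := (Complex.abs_re_le_norm _).trans hcurv
    have h2 : (Z - n).re = Z.re - n := by simp
    rw [h2, abs_le] at h1
    have : (Z / 2).re = Z.re / 2 := by simp
    rw [this]
    linarith [h1.1]
  · have h1 : ‖Z‖ ≤ ‖Z - n‖ + ‖(n : ℂ)‖ := by
      have := norm_add_le (Z - n) (n : ℂ); rwa [sub_add_cancel] at this
    rw [Complex.norm_natCast] at h1
    rw [norm_div, Complex.norm_two]
    linarith

end Summit.RiemannHypothesis.RiemannHypothesis.Theorems.JensenPolynomials.LogBandArc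

end
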